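import Mathlib
import Summits.NavierStokesRegularity.OSWSelfSimilar.SheetNSLineTorusCascadePoleMajorant
import Summits.NavierStokesRegularity.OSWSelfSimilar.SheetNSLineTorusCascadeKernelCellL1976
import Summits.NavierStokesRegularity.OSWSelfSimilar.SheetNSLineTorusCascadeKernelCellU1983
import HarnessLib

/-!
# Viscous CLM on the torus (`a = 0`, `σ = 2`): THE CRITICAL CONSTANT `κ*` OF THE SINE DATUM — definition, enclosure
# `494/25 ≤ κ* ≤ 1983/100`, and the «no delayed blow-up» lemma (receding pole)

HONEST FRAMING (cell ns-blowup GROUP B «PROFILE SEARCH», zone Z3, row Z3-U addendum A-F2 of `HOME/profile/z3/CENSUS-Z3.md`;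
human rulings D-0035/D-0074; Z3-TWIN lineage, eng-5 g14): **1-D MODEL (viscous Constantin–Lax–Majda equation
`ω_t = ω Hω + ν ω_xx` on `𝕋`); real analysis (a supremum and one comparison) on the Fourier cascade, kernel-checked; not Euler, not
Navier–Stokes; «violates: none — MODEL».**

OBJECTS. `E := cascadeSolution 1 (sineDatum 1)` is the universal family (`SheetNSLineTorusCascadeScaling`: the sine cascade with
viscosity `ν` and datum `−c sin x` is `c_k(t) = ν (c/ν)^k E_k(νt)`). This file introduces

* `thresholdSet` — the set of `κ ≥ 0` for which the scaled family `κ^k E_k(τ)` is bounded UNIFORMLY in `k ∈ ℕ` and `τ ≥ 0`;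
* `criticalConstant` — `κ* := sSup thresholdSet`, THE critical constant of the sine datum (the sequel
  `SheetNSLineTorusCascadeThresholdDichotomy` proves: for every `ν > 0`, global classical solution from `−c sin x` iff `c < κ*ν`,
  `c ≠ κ*ν`).

THEOREMS.
* `mem_thresholdSet_of_le` — `thresholdSet` is down-closed; `Ico_subset_thresholdSet` / `thresholdSet_subset_Icc` — it is `[0, κ*)` or
  `[0, κ*]`;
* `mem_thresholdSet_of_lt` — every `0 ≤ κ < 494/25` is in it (eng-5 g13's kernel tail `cellL1976_universal_tail` through
  eng-3's `abs_cascadeSolution_le_of_universal_tail`); `lt_of_mem_thresholdSet` — no `κ ≥ 1983/100` is (g13's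
  `unbounded_of_le_nineteenEightyThree`); hence **`le_criticalConstant` / `criticalConstant_le`: `494/25 ≤ κ* ≤ 1983/100`** —
  every datum-free kernel bracket, present or future, is an enclosure of this ONE number;
* **`uniform_of_window` («NO DELAYED BLOW-UP»)** — if `κ^k E_k(τ) ≤ M` for all `k` and all `τ ∈ [0, log(κ/8)]`, then
  `κ^k E_k(τ) ≤ max M (8k)` for ALL `τ ≥ 0`: by the receding-pole super-solution `mode_le_pole8`
  (`SheetNSLineTorusCascadePoleMajorant`, `c_k(t) ≤ 8ν k (c/(8ν))^k e^{−νkt}`) every mode of the datum-`κ` cascade is `≤ 8k` once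
  `t ≥ log(κ/8)`; so boundedness on the compact window `[0, log(κ/8)]` is the whole question — `mem_thresholdSet_of_window`: such
  a window bound at `κ` puts every `κ′ < κ` into `thresholdSet`, and `le_criticalConstant_of_window`: it forces `κ ≤ κ*`.

bears_on: LADDER-NS N5 / zone Z3 (row Z3-U, A-F2 (t1) datum-free tier) → N1 linear core. WHAT THIS IS NOT: not NS; no PDE statement in
this file (the dichotomy at the PDE level is the sequel); NO new digit of `κ*` (the located `19.7756` and the script-certified interval are
estimates / enclosures of `κ*` from distinct tiers and stay untouched); whether `κ* ∈ thresholdSet` is NOT decided.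
-/

noncomputable section

namespace Summit.NavierStokesRegularity.OSWSelfSimilar
namespace SheetNSLineTorusCascade

open Finset Real Set Filter
open scoped Topology

/-! ### The threshold set and the critical constant -/

/-- **The threshold set of the sine datum**: the amplitudes `κ ≥ 0` (in units of the viscosity) for which the scaled universal family
`κ^k E_k(τ)` (`E = cascadeSolution 1 (sineDatum 1)`, i.e. the sine cascade with `ν = 1` and datum `−κ sin x`) is bounded uniformly in
the mode `k` and the time `τ ≥ 0`. [new here — MODEL] -/
def thresholdSet : Set ℝ :=
  {κ : ℝ | 0 ≤ κ ∧ ∃ C : ℝ, ∀ k : ℕ, ∀ τ : ℝ, 0 ≤ τ → κ ^ k * cascadeSolution 1 (sineDatum 1) k τ ≤ C}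

/-- **The critical constant `κ*` of the sine datum** of the periodic viscous CLM (`a = 0`, `σ = 2`): the supremum of `thresholdSet`.
For every `ν > 0` the datum `−c sin x` is global for `0 ≤ c < κ*ν` and has horizon `< log(c/(8ν))/ν` for `c > κ*ν`
(`SheetNSLineTorusCascadeThresholdDichotomy`); `494/25 ≤ κ* ≤ 1983/100` (this file). [new here — MODEL] -/
def criticalConstant : ℝ := sSup thresholdSet

/-! ### The universal family -/

/-- The universal family is nonnegative on `τ ≥ 0`. -/
theorem universal_nonneg (k : ℕ) {τ : ℝ} (hτ : 0 ≤ τ) : 0 ≤ cascadeSolution 1 (sineDatum 1) k τ :=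
  nonneg (isSineCascade_cascadeSolution 1 1) zero_le_one k τ hτ

/-- Mode `0` of the universal family vanishes. -/
theorem universal_zero (τ : ℝ) : cascadeSolution 1 (sineDatum 1) 0 τ = 0 :=
  (isSineCascade_cascadeSolution 1 1).zero τ

/-- The scaled universal family `κ^k E_k` is the sine cascade with `ν = 1` and datum `κ` (amplitude homogeneity). -/
theorem isSineCascade_smul_universal (κ : ℝ) :
    IsSineCascade 1 κ (fun k t => κ ^ k * cascadeSolution 1 (sineDatum 1) k t) := by
  have h := (isSineCascade_cascadeSolution 1 1).smul_pow κ
  rwa [mul_one] at h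

/-! ### Elementary structure of `thresholdSet` -/

/-- `0 ∈ thresholdSet`. -/
theorem zero_mem_thresholdSet : (0 : ℝ) ∈ thresholdSet := by
  refine ⟨le_rfl, 0, fun k τ _ => ?_⟩
  rcases Nat.eq_zero_or_pos k with hk | hk
  · rw [hk, universal_zero, mul_zero]
  · rw [zero_pow hk.ne', zero_mul]

/-- `thresholdSet` is nonempty. -/
theorem thresholdSet_nonempty : thresholdSet.Nonempty := ⟨0, zero_mem_thresholdSet⟩

/-- **`thresholdSet` is down-closed** in `[0, ∞)`. -/
theorem mem_thresholdSet_of_le {κ κ' : ℝ} (hκ : κ ∈ thresholdSet) (h0 : 0 ≤ κ') (hle : κ' ≤ κ) :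
    κ' ∈ thresholdSet := by
  obtain ⟨-, C, hC⟩ := hκ
  refine ⟨h0, C, fun k τ hτ => le_trans ?_ (hC k τ hτ)⟩
  exact mul_le_mul_of_nonneg_right (pow_le_pow_left₀ h0 hle k) (universal_nonneg k hτ)

/-- The bounding constant of a member is nonnegative (test at `k = 0`, `τ = 0`). -/
theorem thresholdSet_const_nonneg {κ C : ℝ}
    (hC : ∀ k : ℕ, ∀ τ : ℝ, 0 ≤ τ → κ ^ k * cascadeSolution 1 (sineDatum 1) k τ ≤ C) : 0 ≤ C := by
  have h := hC 0 0 le_rfl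
  rwa [pow_zero, one_mul, universal_zero] at h

/-- **No member reaches `1983/100`**: at `κ ≥ 1983/100` the scaled family is unbounded in `k` at the time `600·log(2^12/4093)`
(eng-5 g13's reflective cell-chain certificate `unbounded_of_le_nineteenEightyThree`). [new here — MODEL] -/
theorem lt_of_mem_thresholdSet {κ : ℝ} (hκ : κ ∈ thresholdSet) : κ < 1983 / 100 := by
  by_contra hcon
  obtain ⟨-, C, hC⟩ := hκ
  have hle : 1983 / 100 * (1 : ℝ) ≤ κ := by linarith [not_lt.mp hcon]
  obtain ⟨k, hk⟩ := unbounded_of_le_nineteenEightyThree one_pos hle (isSineCascade_smul_universal κ) C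
  have hτ : (0 : ℝ) ≤ (((600 : ℕ) : ℝ) * Real.log (2 ^ 12 / ((4093 : ℕ) : ℝ))) / 1 :=
    div_nonneg cellU1983_horizon_pos.le zero_le_one
  exact absurd (hC k _ hτ) (not_le.mpr hk)

/-- `thresholdSet` is bounded above (by `1983/100`). -/
theorem bddAbove_thresholdSet : BddAbove thresholdSet :=
  ⟨1983 / 100, fun _ hκ => (lt_of_mem_thresholdSet hκ).le⟩

/-- `k q^k` is bounded for `0 ≤ q < 1`. [folklore] -/
theorem exists_nat_mul_pow_le {q : ℝ} (hq : 0 ≤ q) (hq1 : q < 1) : ∃ B : ℝ, ∀ k : ℕ, (k : ℝ) * q ^ k ≤ B := by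
  obtain ⟨B, hB⟩ := (tendsto_self_mul_const_pow_of_lt_one hq hq1).bddAbove_range
  exact ⟨B, fun k => hB (Set.mem_range_self k)⟩

/-- **Every `0 ≤ κ < 494/25` is in `thresholdSet`**: eng-5 g13's kernel universal tail `E_k(τ) ≤ 12k(25/494)^k` (`k ≥ 61`, all
`τ ≥ 0`; `cellL1976_universal_tail`) through eng-3's envelope `abs_cascadeSolution_le_of_universal_tail` gives
`κ^k E_k(τ) ≤ A·k·(25κ/494)^k ≤ A·B`. [new here — MODEL] -/
theorem mem_thresholdSet_of_lt {κ : ℝ} (h0 : 0 ≤ κ) (hlt : κ < 494 / 25) : κ ∈ thresholdSet := by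
  have hq : 0 ≤ κ * (25 / 494) / 1 := by positivity
  have hq1 : κ * (25 / 494) / 1 < 1 := by rw [div_one]; linarith
  obtain ⟨B, hB⟩ := exists_nat_mul_pow_le hq hq1
  have henv := abs_cascadeSolution_le_of_universal_tail (μ₀ := 25 / 494) (ν := 1) (c := κ) (by norm_num) (by norm_num)
    (k₀ := 61) cellL1976_universal_tail one_pos h0
  set A : ℝ := 12 * 1 * (12 * (25 / 494 : ℝ))⁻¹ ^ 61 with hA
  have hA0 : 0 ≤ A := by positivity
  refine ⟨h0, A * B, fun k τ hτ => ?_⟩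
  have h1 := henv k τ hτ
  rw [cascadeSolution_sine_one_eq_universal κ k τ hτ] at h1
  calc κ ^ k * cascadeSolution 1 (sineDatum 1) k τ
      ≤ |κ ^ k * cascadeSolution 1 (sineDatum 1) k τ| := le_abs_self _
    _ ≤ A * (k : ℝ) * (κ * (25 / 494) / 1) ^ k := h1
    _ = A * ((k : ℝ) * (κ * (25 / 494) / 1) ^ k) := by ring
    _ ≤ A * B := mul_le_mul_of_nonneg_left (hB k) hA0

/-! ### The enclosure of `κ*` -/

/-- Members are below `κ*`. -/
theorem le_criticalConstant_of_mem {κ : ℝ} (hκ : κ ∈ thresholdSet) : κ ≤ criticalConstant :=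
  le_csSup bddAbove_thresholdSet hκ

/-- `0 ≤ κ*`. -/
theorem criticalConstant_nonneg : 0 ≤ criticalConstant := le_criticalConstant_of_mem zero_mem_thresholdSet

/-- **Upper enclosure: `κ* ≤ 1983/100 = 19.83`.** [new here — MODEL] -/
theorem criticalConstant_le : criticalConstant ≤ 1983 / 100 :=
  csSup_le thresholdSet_nonempty fun _ hκ => (lt_of_mem_thresholdSet hκ).le

/-- **Lower enclosure: `494/25 = 19.76 ≤ κ*`.** [new here — MODEL] -/
theorem le_criticalConstant : (494 / 25 : ℝ) ≤ criticalConstant := by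
  by_contra hcon
  have hlt := not_le.mp hcon
  have h0 := criticalConstant_nonneg
  have hmem : (criticalConstant + 494 / 25) / 2 ∈ thresholdSet :=
    mem_thresholdSet_of_lt (by linarith) (by linarith)
  have hle := le_criticalConstant_of_mem hmem
  linarith

/-- `0 < κ*`, indeed `8 < κ*` (used by the receding-pole horizon of the sequel). -/
theorem eight_lt_criticalConstant : 8 < criticalConstant := lt_of_lt_of_le (by norm_num) le_criticalConstant

/-- `0 < κ*`. -/
theorem criticalConstant_pos : 0 < criticalConstant := lt_trans (by norm_num) eight_lt_criticalConstant

/-- Nothing above `κ*` is in `thresholdSet`. -/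
theorem not_mem_thresholdSet_of_criticalConstant_lt {κ : ℝ} (h : criticalConstant < κ) : κ ∉ thresholdSet :=
  fun hκ => absurd (le_criticalConstant_of_mem hκ) (not_le.mpr h)

/-- Below `κ*` there is a larger member. -/
theorem exists_mem_thresholdSet_of_lt {x : ℝ} (h : x < criticalConstant) : ∃ κ ∈ thresholdSet, x < κ :=
  exists_lt_of_lt_csSup thresholdSet_nonempty h

/-- **Every `0 ≤ κ < κ*` is in `thresholdSet`** (down-closedness). -/
theorem mem_thresholdSet_of_lt_criticalConstant {κ : ℝ} (h0 : 0 ≤ κ) (h : κ < criticalConstant) : κ ∈ thresholdSet := by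
  obtain ⟨κ₁, hκ₁, hlt⟩ := exists_mem_thresholdSet_of_lt h
  exact mem_thresholdSet_of_le hκ₁ h0 hlt.le

/-- `[0, κ*) ⊆ thresholdSet`. -/
theorem Ico_subset_thresholdSet : Ico 0 criticalConstant ⊆ thresholdSet :=
  fun _ hκ => mem_thresholdSet_of_lt_criticalConstant hκ.1 hκ.2

/-- `thresholdSet ⊆ [0, κ*]` — so `thresholdSet` is `[0, κ*)` or `[0, κ*]` (which one is not decided here). -/
theorem thresholdSet_subset_Icc : thresholdSet ⊆ Icc 0 criticalConstant :=
  fun _ hκ => ⟨hκ.1, le_criticalConstant_of_mem hκ⟩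

/-! ### No delayed blow-up: the receding pole clears the unit circle at `τ = log(κ/8)` -/

/-- The receding pole of amplitude `8` on the scaled universal family: `κ^k E_k(τ) ≤ 8k·((κ/8)e^{−τ})^k` (`κ ≥ 0`, `τ ≥ 0`);
this is `mode_le_pole8` at `ν = 1`, `c = κ`. [new here — MODEL] -/
theorem smul_universal_le_pole8 {κ : ℝ} (hκ : 0 ≤ κ) (k : ℕ) {τ : ℝ} (hτ : 0 ≤ τ) :
    κ ^ k * cascadeSolution 1 (sineDatum 1) k τ ≤ 8 * (k : ℝ) * (κ / 8 * Real.exp (-τ)) ^ k := by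
  have h := mode_le_pole8 (isSineCascade_smul_universal κ) one_pos hκ k τ hτ
  have hexp : Real.exp (-((1 : ℝ) * (k : ℝ) * τ)) = Real.exp (-τ) ^ k := by
    rw [← Real.exp_nat_mul]; congr 1; ring
  rw [hexp] at h
  calc κ ^ k * cascadeSolution 1 (sineDatum 1) k τ
      ≤ 8 * 1 * (k : ℝ) * (κ / (8 * 1)) ^ k * Real.exp (-τ) ^ k := h
    _ = 8 * (k : ℝ) * (κ / 8 * Real.exp (-τ)) ^ k := by rw [mul_pow]; ring

/-- **After `τ = log(κ/8)` every mode of the datum-`κ` cascade is at most `8k`.** [new here — MODEL] -/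
theorem smul_universal_le_of_log_le {κ : ℝ} (hκ : 0 ≤ κ) (k : ℕ) {τ : ℝ} (hτ : 0 ≤ τ)
    (hlog : Real.log (κ / 8) ≤ τ) : κ ^ k * cascadeSolution 1 (sineDatum 1) k τ ≤ 8 * (k : ℝ) := by
  have h := smul_universal_le_pole8 hκ k hτ
  have hr0 : 0 ≤ κ / 8 * Real.exp (-τ) := by positivity
  have he1 : Real.exp (-τ) ≤ 1 := Real.exp_le_one_iff.mpr (by linarith)
  have hr1 : κ / 8 * Real.exp (-τ) ≤ 1 := by
    rcases le_or_gt κ 8 with h8 | h8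
    · calc κ / 8 * Real.exp (-τ) ≤ 1 * 1 :=
            mul_le_mul (by linarith) he1 (Real.exp_pos _).le zero_le_one
        _ = 1 := one_mul 1
    · have hpos : 0 < κ / 8 := by positivity
      have hexp : Real.exp (-τ) ≤ (κ / 8)⁻¹ :=
        calc Real.exp (-τ) ≤ Real.exp (-Real.log (κ / 8)) := Real.exp_le_exp.mpr (by linarith)
          _ = (κ / 8)⁻¹ := by rw [Real.exp_neg, Real.exp_log hpos]
      calc κ / 8 * Real.exp (-τ) ≤ κ / 8 * (κ / 8)⁻¹ := mul_le_mul_of_nonneg_left hexp hpos.le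
        _ = 1 := mul_inv_cancel₀ hpos.ne'
  calc κ ^ k * cascadeSolution 1 (sineDatum 1) k τ ≤ 8 * (k : ℝ) * (κ / 8 * Real.exp (-τ)) ^ k := h
    _ ≤ 8 * (k : ℝ) * 1 := mul_le_mul_of_nonneg_left (pow_le_one₀ hr0 hr1) (by positivity)
    _ = 8 * (k : ℝ) := mul_one _

/-- **NO DELAYED BLOW-UP.** If `κ^k E_k(τ) ≤ M` for every mode `k` and every `τ` in the compact window `[0, log(κ/8)]` (`κ ≥ 0`),
then `κ^k E_k(τ) ≤ max M (8k)` for EVERY `τ ≥ 0`. [new here — MODEL] -/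
theorem uniform_of_window {κ M : ℝ} (hκ : 0 ≤ κ)
    (hM : ∀ k : ℕ, ∀ τ ∈ Icc (0 : ℝ) (Real.log (κ / 8)), κ ^ k * cascadeSolution 1 (sineDatum 1) k τ ≤ M) :
    ∀ k : ℕ, ∀ τ : ℝ, 0 ≤ τ → κ ^ k * cascadeSolution 1 (sineDatum 1) k τ ≤ max M (8 * (k : ℝ)) := by
  intro k τ hτ
  rcases le_or_gt τ (Real.log (κ / 8)) with h | h
  · exact (hM k τ ⟨hτ, h⟩).trans (le_max_left _ _)
  · exact (smul_universal_le_of_log_le hκ k hτ h.le).trans (le_max_right _ _)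

/-- **A window bound at `κ` puts every smaller amplitude into `thresholdSet`** (the factor `(κ′/κ)^k` absorbs the `8k`).
[new here — MODEL] -/
theorem mem_thresholdSet_of_window {κ κ' M : ℝ} (hκ' : 0 ≤ κ') (hlt : κ' < κ)
    (hM : ∀ k : ℕ, ∀ τ ∈ Icc (0 : ℝ) (Real.log (κ / 8)), κ ^ k * cascadeSolution 1 (sineDatum 1) k τ ≤ M) :
    κ' ∈ thresholdSet := by
  have hκ : 0 < κ := lt_of_le_of_lt hκ' hlt
  have hq : 0 ≤ κ' / κ := div_nonneg hκ' hκ.le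
  have hq1 : κ' / κ < 1 := (div_lt_one hκ).mpr hlt
  obtain ⟨B, hB⟩ := exists_nat_mul_pow_le hq hq1
  have hunif := uniform_of_window hκ.le hM
  refine ⟨hκ', max M 0 + 8 * B, fun k τ hτ => ?_⟩
  have hk := hunif k τ hτ
  have hid : κ' ^ k * cascadeSolution 1 (sineDatum 1) k τ
      = (κ' / κ) ^ k * (κ ^ k * cascadeSolution 1 (sineDatum 1) k τ) := by
    rw [div_pow, ← mul_assoc, div_mul_cancel₀ _ (pow_ne_zero k hκ.ne')]
  rw [hid]
  have hqk : (κ' / κ) ^ k ≤ 1 := pow_le_one₀ hq hq1.le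
  have hqk0 : 0 ≤ (κ' / κ) ^ k := pow_nonneg hq k
  have hmax : max M (8 * (k : ℝ)) ≤ max M 0 + 8 * (k : ℝ) :=
    max_le (by linarith [le_max_left M 0, (Nat.cast_nonneg k : (0 : ℝ) ≤ k)]) (by linarith [le_max_right M 0])
  calc (κ' / κ) ^ k * (κ ^ k * cascadeSolution 1 (sineDatum 1) k τ)
      ≤ (κ' / κ) ^ k * (max M 0 + 8 * (k : ℝ)) := mul_le_mul_of_nonneg_left (hk.trans hmax) hqk0
    _ = (κ' / κ) ^ k * max M 0 + 8 * ((k : ℝ) * (κ' / κ) ^ k) := by ring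
    _ ≤ 1 * max M 0 + 8 * B :=
        add_le_add (mul_le_mul_of_nonneg_right hqk (le_max_right M 0)) (by linarith [hB k])
    _ = max M 0 + 8 * B := by ring

/-- **A window bound at `κ` forces `κ ≤ κ*`.** [new here — MODEL] -/
theorem le_criticalConstant_of_window {κ M : ℝ}
    (hM : ∀ k : ℕ, ∀ τ ∈ Icc (0 : ℝ) (Real.log (κ / 8)), κ ^ k * cascadeSolution 1 (sineDatum 1) k τ ≤ M) :
    κ ≤ criticalConstant := by
  refine le_of_forall_lt_imp_le_of_dense fun κ' hκ' => ?_
  rcases lt_or_ge κ' 0 with h | h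
  · exact h.le.trans criticalConstant_nonneg
  · exact le_criticalConstant_of_mem (mem_thresholdSet_of_window h hκ' hM)

/-- **Members have window bounds, trivially; conversely a member's bound is global by definition.** For `κ ∈ thresholdSet` every
`κ′ ∈ [0, κ]` is a member (`mem_thresholdSet_of_le`), and `κ ≤ κ*`; the content of this section is the converse direction
`le_criticalConstant_of_window`, which needs only the COMPACT window `[0, log(κ/8)]`. -/
theorem window_of_mem {κ : ℝ} (hκ : κ ∈ thresholdSet) :
    ∃ M : ℝ, ∀ k : ℕ, ∀ τ ∈ Icc (0 : ℝ) (Real.log (κ / 8)), κ ^ k * cascadeSolution 1 (sineDatum 1) k τ ≤ M := by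
  obtain ⟨-, C, hC⟩ := hκ
  exact ⟨C, fun k τ hτ => hC k τ hτ.1⟩

end SheetNSLineTorusCascade
end Summit.NavierStokesRegularity.OSWSelfSimilar
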